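/-
Chen 2024 (IACR ePrint 2024/555, version of 2024-04-18), §1.2 eq. (1) p. 3, eq. (2) p. 3, the "Karst wave"
display p. 4, Lemma 2.4 (Poisson summation) p. 10, Cond. C.5 p. 19, Step 1 (`|φ′₁⟩`, Lemma 3.10) p. 23,
Step 2 eq. (18) p. 24: the complex-Gaussian WINDOW `f_{r,s}(x) = exp(-π(1/r² + i/s²)x²)` and the three exact
identities the front end (Steps 1–7) is built from — the discrete Fourier transform of the (periodised)
window is a periodised complex Gaussian of the DUAL rate `r²s²(s² - r²i)/(s⁴ + r⁴)` (the Karst wave), the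
Karst-wave COMB (second Poisson step under the integrality condition of §1.2 / C.5), and Step 2 / eq. (18):
`QFT_{ℤ_Pⁿ}` of the untruncated Step-1 line state `|φ′₁⟩` in closed form, with every constant the paper
drops under `∝` made explicit.  All three are THEOREMS here (kernel-checked instances of Jacobi's imaginary
transformation, Mathlib `Complex.tsum_exp_neg_quadratic`), stated for the exact, untruncated objects; the
`≈_t` truncations to `r log n · B_∞ⁿ` (Lemma 3.10, Lemma 2.15) are NOT treated (they are the `δ` of
`ChenQuantumLWEStateRobustness`).

REPRODUCTION / ANALYSIS OF A CLAIMED RESULT UNDER ADJUDICATION (withdrawn by its author, note of 2024-04-18).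
HONEST FRAMING: the VALUE is a THEOREM / DECIDABLE VERDICT / CERTIFICATE / precise negative result — NOT
summit progress.  Theorems about a WITHDRAWN algorithm: they certify that eq. (1), the Karst-wave display and
eq. (18)(b) are CORRECT as exact identities (the defect of the paper is elsewhere: the periodicity premise of
Lemma 2.17 in Step 9, `ChenQuantumLWESteps`); nothing is repaired, nothing is broken, no cryptanalytic claim.
No named fact is introduced (debt 0).
-/
import Literature.Computability.Cryptography.ChenQuantumLWEProductProofs
import Mathlib.Analysis.SpecialFunctions.Gaussian.PoissonSummation
import Mathlib.NumberTheory.ModularForms.JacobiTheta.TwoVariable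

/-!
# Chen 2024, §1.2 and Steps 1–2: the complex Gaussian window, the Karst wave, eq. (18) — exactly

Chen's front end rests on "Gaussian functions with complex variances" (§1.2, pp. 3–4): for `r, s > 0` the
window `f_{r,s}(x) := exp(-π(1/r² + i/s²)x²)` (`cgauss`, rate `κ_{r,s} = 1/r² + i/s²`, `karstRate`), the
Fourier pair of eq. (1) `g(x) = exp(-πx²/(a+bi))`, `ĝ(y) = √(a+bi)·exp(-π(a+bi)y²)` (`a > 0`), and three
"features": (i) `f_{r,s}` = real Gaussian × quadratic phase (state preparation by Grover–Rudolph + phase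
kickback, p. 3; `cgauss_eq_gauss_mul_phase`); (ii) "center = phase", eq. (2) p. 3 (`center_eq_phase`);
(iii) the KARST WAVE (p. 4): `QFT_{ℤ_P}` of `Σ_{x∈ℤ_P} f_{r,s}(x)|x⟩` is `Σ_y Σ_{z∈Pℤ} exp(-π r²s²(s²-r²i)
/(P²(s⁴+r⁴))·(y+z)²)|y⟩` "by the Poisson summation formula (Lemma 2.4)", and when the chirp rate
`r⁴s²/(s⁴+r⁴)` is an even integer a second Poisson step turns this into a comb of Gaussians of width `≈ P/r`
centred near `(P/s²)ℤ` (the display on p. 4; Cond. C.5 p. 19 is the Step-6 instance of the integrality).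
Step 1 (p. 23) produces, up to `≈_t` (Lemma 3.10), `|φ′₁⟩ := Σ_{k∈ℤ} f_{r,s}-weight(‖kx − y‖²)|kx − y mod P⟩`
and Step 2 (eq. (18) p. 24) computes `|φ₂⟩ = QFT_{ℤ_Pⁿ}|φ′₁⟩` in closed form "(b) uses PSF (Lemma 2.4) and
the Fourier transformation of complex Gaussian (Eqn. (1))".

## What is proved (every identity exact, for the UNTRUNCATED objects; constants explicit)

* `tsum_cexp_neg_quadratic_shift` — the master identity behind all of §1.2 / eq. (18): for `Re a > 0` and
  any `c, w ∈ ℂ`, `Σ_{k∈ℤ} e^{-πa(k-c)²} e^{-2πikw} = a^{-1/2} Σ_{j∈ℤ} e^{-(π/a)(j+w)²} e^{-2πic(j+w)}`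
  (Jacobi's imaginary transformation with both a shift and a twist; from Mathlib's
  `Complex.tsum_exp_neg_quadratic`).  `summable_cexp_neg_quadratic`: the series converge absolutely.
* `inv_karstRate` — the dual rate: `(1/r² + i/s²)⁻¹ = r²s²(s² − r²i)/(s⁴ + r⁴)` (the constant printed in the
  Karst-wave display and in eq. (18)); `karstRate_re_pos`.
* **`karstWave_poisson`**, **`karstWave`** (§1.2 (a), p. 4): `Σ_{x∈ℤ} f_{r,s}(x) e^{-2πixy/P}
  = κ_{r,s}^{-1/2} · Σ_{z∈ℤ} exp(-π r²s²(s²-r²i)/(P²(s⁴+r⁴))·(y + Pz)²)` for every `y` — Chen's display with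
  the dropped constant `κ^{-1/2} = √(a+bi)` restored; **`qft_periodised`** + **`karstWave_qft`**: the
  amplitude of `|y⟩` in `QFT_{ℤ_P}(Σ_{x∈ℤ_P} F(x)|x⟩)`, `F` = the `P`-periodisation of `f_{r,s}` (which is what
  a register holding `x mod P` carries), is exactly that right-hand side (`tsum_int_eq_sum_residue`: a
  summable series over `ℤ` summed by residue classes mod `P`, the `ℤ`-analogue of Mathlib's
  `Nat.sumByResidueClasses`).
* **`karstWave_comb`**, **`karstWave_comb_chen`** (§1.2 second display, p. 4): if the chirp rate `κ' =
  r⁴s²/(s⁴+r⁴)` satisfies `κ' ∈ 2ℤ` (Chen prints the stronger `κ'/2 ∈ 2ℤ`; `karstWave_comb_chen` takes his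
  hypothesis verbatim), then for every `t` (`= y/P`)
  `Σ_{m∈ℤ} exp(-π r²s²(s²-r²i)/(s⁴+r⁴)·(m+t)²) = e^{πiκ't²} α^{-1/2} Σ_{j∈ℤ} exp(-π(s⁴+r⁴)/(r²s⁴)·(j − κ't)²)
  · e^{2πit(j − κ't)}`, `α = r²s⁴/(s⁴+r⁴)` — Gaussians in `κ't = κ'y/P` centred on `ℤ`, i.e. `y` near
  `(P/κ')ℤ = P(s⁴+r⁴)/(r⁴s²)·ℤ`, exactly as printed.
* **`step2_tsum_exact`**, **`step2_tsum_exact_chen`** (eq. (18), p. 24): for `x ≠ 0`, `y, z ∈ ℤⁿ`,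
  `Σ_{k∈ℤ} exp(-πκ‖kx−y‖²) e^{-2πi⟨kx−y,z⟩/P} = exp(-πκ(‖y‖² − ⟨x,y⟩²/‖x‖²)) · e^{2πi⟨y,z⟩/P} ·
  (κ‖x‖²)^{-1/2} · Σ_{j∈ℤ} exp(-π r²s²(s²−r²i)/(‖x‖²(s⁴+r⁴))·(j + ⟨x,z⟩/P)²) e^{-2πi(⟨x,y⟩/‖x‖²)(j + ⟨x,z⟩/P)}`
  — eq. (18)(a)(b) with the two "global amplitude" factors Chen drops made explicit; and at the level of
  kets, with Chen's `QFT_{ℤ_Pⁿ}` of `ChenQuantumLWESteps` (`qft`, sign `e^{-2πi⟨·,·⟩/P}`):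
  **`qft_phi1Prime`** (`|φ₂⟩ := QFT|φ′₁⟩` has amplitude the left-hand side above at every `z ∈ ℤ_Pⁿ`,
  `phi1Prime` = the untruncated Step-1 state of p. 23) and **`qft_phi1Prime_eq`** (the closed form).

## What is NOT here

No truncation / tail estimate (`|φ₁⟩` vs `|φ′₁⟩`, Lemma 3.10; the boxes `R√n B₂ⁿ`, `R log n B_∞ⁿ` of Lemma
2.15; the `≈_t` in (18)): these are the `2^{-Ω(n)}` relative errors transported by
`ChenQuantumLWEStateRobustness`.  No claim about Steps 3–7 (eq. (19)–(34)), whose analysis (Lemmas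
3.20–3.29, pp. 41–56) iterates the same two identities with further windows; no efficiency / precision
statement (Lemma 2.15's `2^{-Ω(n)}`-close state preparation); no normalisation of states.
-/

namespace Literature.Computability.Cryptography.Chen2024

open scoped BigOperators Real
open Complex hiding exp continuous_exp exp_add

noncomputable section

/-! ### Summing a series over `ℤ` by residue classes -/

/-- `ℤ ≃ ℤ_P × ℤ`, `n ↦ (n mod P, ⌊n/P⌋)`, inverse `(x, m) ↦ x.val + P·m` (the `ℤ`-analogue of Mathlib's
`Nat.residueClassesEquiv`). [folklore] -/
def intResidueClassesEquiv (P : ℕ) [NeZero P] : ℤ ≃ ZMod P × ℤ where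
  toFun n := ((n : ZMod P), n / P)
  invFun p := (p.1.val : ℤ) + P * p.2
  left_inv n := by
    have h := ZMod.val_intCast (n := P) n
    simp only
    rw [h]
    exact Int.emod_add_mul_ediv n P
  right_inv p := by
    rcases p with ⟨x, m⟩
    have hP : (P : ℤ) ≠ 0 := by exact_mod_cast NeZero.ne P
    ext
    · simp only
      push_cast
      simp
    · simp only
      rw [Int.add_mul_ediv_left _ _ hP, Int.ediv_eq_zero_of_lt (by positivity)
        (by exact_mod_cast ZMod.val_lt x), zero_add]

/-- A summable series over `ℤ` may be summed residue class by residue class: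
`Σ_{n∈ℤ} g(n) = Σ_{x∈ℤ_P} Σ_{m∈ℤ} g(x.val + P·m)`. [folklore] -/
theorem tsum_int_eq_sum_residue (P : ℕ) [NeZero P] {g : ℤ → ℂ} (hg : Summable g) :
    ∑' n : ℤ, g n = ∑ x : ZMod P, ∑' m : ℤ, g ((x.val : ℤ) + P * m) := by
  rw [← (intResidueClassesEquiv P).symm.tsum_eq g, Summable.tsum_prod, tsum_fintype]
  · rfl
  · exact hg.comp_injective (intResidueClassesEquiv P).symm.injective

/-! ### Jacobi's imaginary transformation with a shift and a twist -/

/-- The Gaussian series `Σ_{n∈ℤ} e^{-πan² + 2πbn}` converges absolutely for `Re a > 0` (it is a Jacobi theta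
series `θ₂`-term with `τ = ia`, `Im τ = Re a > 0`). [folklore] -/
theorem summable_cexp_neg_quadratic {a : ℂ} (ha : 0 < a.re) (b : ℂ) :
    Summable fun n : ℤ => cexp (-π * a * n ^ 2 + 2 * π * b * n) := by
  have h : (fun n : ℤ => cexp (-π * a * n ^ 2 + 2 * π * b * n))
      = fun n : ℤ => jacobiTheta₂_term n (-I * b) (I * a) := by
    funext n
    rw [jacobiTheta₂_term]
    congr 1
    ring_nf
    rw [I_sq]
    ring
  rw [h, summable_jacobiTheta₂_term_iff]
  simpa using ha

/-- **Master identity.**  For `Re a > 0` and all `c, w ∈ ℂ`: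
`Σ_{k∈ℤ} e^{-πa(k-c)²}·e^{-2πikw} = a^{-1/2} · Σ_{j∈ℤ} e^{-(π/a)(j+w)²}·e^{-2πic(j+w)}` — the Poisson
summation formula (Chen's Lemma 2.4) applied to the complex Gaussian of eq. (1) with centre `c` read as a
phase on the dual side ("center = phase").  From Mathlib's `Complex.tsum_exp_neg_quadratic`.
[cite: ChenQuantumLattice2024, §1.2 eq. (1)–(2) p. 3; Lemma 2.4 p. 10] -/
theorem tsum_cexp_neg_quadratic_shift {a : ℂ} (ha : 0 < a.re) (c w : ℂ) :
    ∑' k : ℤ, cexp (-π * a * (k - c) ^ 2) * cexp (-2 * π * I * k * w) =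
      1 / a ^ (1 / 2 : ℂ) *
        ∑' j : ℤ, cexp (-π / a * (j + w) ^ 2) * cexp (-2 * π * I * c * (j + w)) := by
  have ha0 : a ≠ 0 := fun h => by simp [h] at ha
  have hL : ∀ k : ℤ, cexp (-π * a * (k - c) ^ 2) * cexp (-2 * π * I * k * w)
      = cexp (-π * a * c ^ 2) * cexp (-π * a * k ^ 2 + 2 * π * (a * c - I * w) * k) := by
    intro k
    rw [← Complex.exp_add, ← Complex.exp_add]
    congr 1
    ring
  have hR : ∀ j : ℤ, cexp (-π * a * c ^ 2) * cexp (-π / a * (j + I * (a * c - I * w)) ^ 2)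
      = cexp (-π / a * (j + w) ^ 2) * cexp (-2 * π * I * c * (j + w)) := by
    intro j
    rw [← Complex.exp_add, ← Complex.exp_add]
    congr 1
    have key : (j : ℂ) + I * (a * c - I * w) = (j + w) + I * a * c := by
      simp only [mul_sub, ← mul_assoc, I_mul_I]
      ring
    rw [key, add_sq, mul_pow, mul_pow, I_sq]
    field_simp
    ring
  simp_rw [hL]
  rw [tsum_mul_left, Complex.tsum_exp_neg_quadratic ha, ← mul_assoc, mul_comm (cexp _) (1 / _),
    mul_assoc, ← tsum_mul_left]
  simp_rw [hR]

/-! ### The complex Gaussian window of §1.2 -/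

/-- Chen's complex rate `κ_{r,s} := 1/r² + i/s²`: `f_{r,s}(x) = exp(-π κ_{r,s} x²)` (§1.2 p. 3; in eq. (1)
`κ = 1/(a+bi)`). [cite: ChenQuantumLattice2024, §1.2 eq. (1) p. 3] -/
def karstRate (r s : ℝ) : ℂ := ((1 / r ^ 2 : ℝ) : ℂ) + ((1 / s ^ 2 : ℝ) : ℂ) * I

/-- `Re κ_{r,s} = 1/r²`. [cite: ChenQuantumLattice2024, §1.2 p. 3] -/
theorem karstRate_re (r s : ℝ) : (karstRate r s).re = 1 / r ^ 2 := by
  simp only [karstRate, add_re, ofReal_re, re_ofReal_mul, I_re, mul_zero, add_zero]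

/-- `Re κ_{r,s} > 0` for `r ≠ 0` — the hypothesis `a > 0` of eq. (1) (the real part of the VARIANCE
`1/κ = a + bi` is then positive too, `inv_karstRate`). [cite: ChenQuantumLattice2024, §1.2 eq. (1) p. 3] -/
theorem karstRate_re_pos {r : ℝ} (hr : r ≠ 0) (s : ℝ) : 0 < (karstRate r s).re := by
  rw [karstRate_re]
  positivity

/-- The DUAL rate: `κ_{r,s}⁻¹ = r²s²(s² − r²i)/(s⁴ + r⁴)` — the constant printed in the Karst-wave display
(p. 4: `exp(-π r²s²(s²−r²i)/(P²(s⁴+r⁴))·(y+z)²)`) and in eq. (18)(b) (p. 24).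
[cite: ChenQuantumLattice2024, §1.2 p. 4; eq. (18) p. 24] -/
theorem inv_karstRate {r s : ℝ} (hr : r ≠ 0) (hs : s ≠ 0) :
    (karstRate r s)⁻¹ = (r : ℂ) ^ 2 * s ^ 2 * (s ^ 2 - r ^ 2 * I) / (s ^ 4 + r ^ 4) := by
  have h4 : (s : ℂ) ^ 4 + r ^ 4 ≠ 0 := by
    have h : (0 : ℝ) < s ^ 4 + r ^ 4 := by positivity
    exact_mod_cast h.ne'
  have hr' : (r : ℂ) ≠ 0 := by exact_mod_cast hr
  have hs' : (s : ℂ) ≠ 0 := by exact_mod_cast hs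
  apply inv_eq_of_mul_eq_one_right
  unfold karstRate
  push_cast
  rw [mul_div_assoc', div_eq_one_iff_eq h4]
  field_simp
  linear_combination (-(r : ℂ) ^ 4) * I_sq

/-- Chen's window `f_{r,s}(x) := exp(-π(1/r² + i/s²)x²)` (§1.2 p. 3), as a function of a complex argument
(evaluated below at integers). [cite: ChenQuantumLattice2024, §1.2 p. 3] -/
def cgauss (r s : ℝ) (x : ℂ) : ℂ := cexp (-π * karstRate r s * x ^ 2)

/-- Feature (i), p. 3 (state preparation by Grover–Rudolph followed by the phase kickback
`|x⟩ ↦ e^{-πi x²/s²}|x⟩`): `f_{r,s}(x) = e^{-πx²/r²} · e^{-πi x²/s²}`.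
[cite: ChenQuantumLattice2024, §1.2 p. 3] -/
theorem cgauss_eq_gauss_mul_phase (r s : ℝ) (x : ℂ) :
    cgauss r s x = cexp (-π * x ^ 2 / r ^ 2) * cexp (-π * I * x ^ 2 / s ^ 2) := by
  rw [cgauss, karstRate, ← Complex.exp_add]
  congr 1
  push_cast
  ring

/-- Feature (ii), "center = phase", eq. (2) p. 3: `e^{-πi(x−c)²/s²} = e^{-πi x²/s²}·e^{2πi cx/s²}·
e^{-πi c²/s²}`. [cite: ChenQuantumLattice2024, §1.2 eq. (2) p. 3] -/
theorem center_eq_phase (s : ℝ) (x c : ℂ) :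
    cexp (-π * I * (x - c) ^ 2 / s ^ 2) =
      cexp (-π * I * x ^ 2 / s ^ 2) * cexp (2 * π * I * c * x / s ^ 2) * cexp (-π * I * c ^ 2 / s ^ 2) := by
  rw [← Complex.exp_add, ← Complex.exp_add]
  congr 1
  ring

/-- The window is absolutely summable over `ℤ`. [cite: ChenQuantumLattice2024, §1.2 p. 3] -/
theorem summable_cgauss {r : ℝ} (hr : 0 < r) (s : ℝ) : Summable fun n : ℤ => cgauss r s n :=
  (summable_cexp_neg_quadratic (karstRate_re_pos hr.ne' s) 0).congr fun n => by
    simp only [mul_zero, zero_mul, add_zero, cgauss]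

/-! ### Feature (iii): the Karst wave (§1.2 p. 4, step (a) = Poisson summation, Lemma 2.4) -/

/-- The Poisson step (a) of the Karst-wave display for a general rate `a`, `Re a > 0`:
`Σ_{x∈ℤ} e^{-πax²} e^{-2πixy/P} = a^{-1/2} Σ_{z∈ℤ} e^{-(π/(aP²))(y + Pz)²}` for every `y`.
[cite: ChenQuantumLattice2024, §1.2 p. 4; Lemma 2.4 p. 10] -/
theorem karstWave_poisson {a : ℂ} (ha : 0 < a.re) {P : ℕ} (hP : P ≠ 0) (y : ℂ) :
    ∑' x : ℤ, cexp (-π * a * x ^ 2) * cexp (-2 * π * I * x * y / P) =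
      1 / a ^ (1 / 2 : ℂ) * ∑' z : ℤ, cexp (-π / (a * P ^ 2) * (y + P * z) ^ 2) := by
  have ha0 : a ≠ 0 := fun h => by simp [h] at ha
  have hP' : (P : ℂ) ≠ 0 := by exact_mod_cast hP
  have h := tsum_cexp_neg_quadratic_shift ha 0 (y / P)
  have e1 : (fun x : ℤ => cexp (-π * a * x ^ 2) * cexp (-2 * π * I * x * y / P))
      = fun k : ℤ => cexp (-π * a * (k - 0) ^ 2) * cexp (-2 * π * I * k * (y / P)) := by
    funext k
    congr 2 <;> ring
  have e2 : (fun z : ℤ => cexp (-π / (a * P ^ 2) * (y + P * z) ^ 2))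
      = fun j : ℤ => cexp (-π / a * (j + y / P) ^ 2) * cexp (-2 * π * I * 0 * (j + y / P)) := by
    funext j
    rw [show -2 * π * I * 0 * (j + y / P) = 0 by ring, Complex.exp_zero, mul_one]
    congr 1
    field_simp
    ring
  rw [e1, e2]
  exact h

/-- **The Karst wave (§1.2 p. 4), exactly.**  For `r, s > 0`, `P ≥ 1` and every `y`:
`Σ_{x∈ℤ} f_{r,s}(x) e^{-2πixy/P} = κ_{r,s}^{-1/2} · Σ_{z∈ℤ} exp(-π r²s²(s²−r²i)/(P²(s⁴+r⁴)) · (y + Pz)²)` —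
Chen's display `Σ_{z∈Pℤ} exp(-π r²s²(s²−r²i)/(P²(s⁴+r⁴))(y+z)²)` with the constant `κ^{-1/2}` (the `√(a+bi)`
of eq. (1), dropped in the display) restored. [cite: ChenQuantumLattice2024, §1.2 p. 4; eq. (1) p. 3] -/
theorem karstWave {r s : ℝ} (hr : 0 < r) (hs : 0 < s) {P : ℕ} (hP : P ≠ 0) (y : ℂ) :
    ∑' x : ℤ, cgauss r s x * cexp (-2 * π * I * x * y / P) =
      1 / karstRate r s ^ (1 / 2 : ℂ) *
        ∑' z : ℤ, cexp (-π * ((r : ℂ) ^ 2 * s ^ 2 * (s ^ 2 - r ^ 2 * I) / (P ^ 2 * (s ^ 4 + r ^ 4)))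
          * (y + P * z) ^ 2) := by
  have h4 : (s : ℂ) ^ 4 + r ^ 4 ≠ 0 := by
    have h : (0 : ℝ) < s ^ 4 + r ^ 4 := by positivity
    exact_mod_cast h.ne'
  have hP' : (P : ℂ) ≠ 0 := by exact_mod_cast hP
  have hκ : karstRate r s ≠ 0 := fun h => by simpa [h] using karstRate_re_pos hr.ne' s
  have h := karstWave_poisson (karstRate_re_pos hr.ne' s) hP y
  unfold cgauss
  rw [h]
  congr 1
  refine tsum_congr fun z => ?_
  congr 1
  rw [div_eq_mul_inv (-(π : ℂ)), mul_inv, inv_karstRate hr.ne' hs.ne']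
  field_simp

/-- `QFT_{ℤ_P}` of a PERIODISED amplitude (`= qft` of `ChenQuantumLWESteps` with one register, written out):
if the register `|x mod P⟩` carries `F(x) = Σ_{m∈ℤ} g(x + Pm)` (`g` summable), then the amplitude of `|u⟩`
after `QFT_{ℤ_P}` (kernel `e^{-2πi x u/P}`, Lemma 2.12) is `Σ_{n∈ℤ} g(n) e^{-2πi n u/P}`.
[cite: ChenQuantumLattice2024, Lemma 2.12 p. 12; §1.2 p. 4] -/
theorem qft_periodised (P : ℕ) [NeZero P] {g : ℤ → ℂ} (hg : Summable g) (u : ZMod P) :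
    ∑ x : ZMod P, (∑' m : ℤ, g ((x.val : ℤ) + P * m)) * e (-(((x.val * u.val : ℕ) : ℚ) / P))
      = ∑' n : ℤ, g n * cexp (-2 * π * I * n * u.val / P) := by
  have hP' : (P : ℂ) ≠ 0 := by exact_mod_cast NeZero.ne P
  have hnorm : ∀ n : ℤ, ‖cexp (-2 * π * I * n * u.val / P)‖ = 1 := by
    intro n
    rw [show -2 * π * I * n * u.val / P = ((-2 * π * n * u.val / P : ℝ) : ℂ) * I by push_cast; ring]
    exact Complex.norm_exp_ofReal_mul_I _
  have hs : Summable fun n : ℤ => g n * cexp (-2 * π * I * n * u.val / P) :=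
    hg.norm.of_norm_bounded fun n => by rw [norm_mul, hnorm, mul_one]
  rw [tsum_int_eq_sum_residue P hs]
  refine Finset.sum_congr rfl fun x _ => ?_
  rw [← tsum_mul_right]
  refine tsum_congr fun m => ?_
  congr 1
  have h1 : cexp (-2 * π * I * (((x.val : ℤ) + P * m : ℤ) : ℂ) * u.val / P)
      = cexp (-2 * π * I * (x.val : ℂ) * u.val / P) * cexp ((-(m * u.val : ℤ) : ℤ) * (2 * π * I)) := by
    rw [← Complex.exp_add]
    congr 1
    push_cast
    field_simp
    ring
  rw [h1, Complex.exp_int_mul_two_pi_mul_I, mul_one, e]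
  congr 1
  push_cast
  ring

/-- **The Karst wave as a statement about `QFT_{ℤ_P}` (§1.2 p. 4).**  The register prepared in feature (i)
holds `x mod P` with the periodised window `F(x) = Σ_m f_{r,s}(x + Pm)` (Chen writes `Σ_{x∈ℤ_P} f_{r,s}(x)|x⟩`,
`P ≥ r√n`, the wrap-around being `2^{-Ω(n)}`); after `QFT_{ℤ_P}` the amplitude of `|u⟩` is EXACTLY
`κ^{-1/2} Σ_{z∈ℤ} exp(-π r²s²(s²−r²i)/(P²(s⁴+r⁴))·(u + Pz)²)` (`u` read in `[0,P)`; the sum over `z` makes the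
right-hand side independent of the representative). [cite: ChenQuantumLattice2024, §1.2 p. 4; Lemma 2.4 p. 10] -/
theorem karstWave_qft {r s : ℝ} (hr : 0 < r) (hs : 0 < s) (P : ℕ) [NeZero P] (u : ZMod P) :
    ∑ x : ZMod P, (∑' m : ℤ, cgauss r s (((x.val : ℤ) + P * m : ℤ) : ℂ))
        * e (-(((x.val * u.val : ℕ) : ℚ) / P))
      = 1 / karstRate r s ^ (1 / 2 : ℂ) *
        ∑' z : ℤ, cexp (-π * ((r : ℂ) ^ 2 * s ^ 2 * (s ^ 2 - r ^ 2 * I) / (P ^ 2 * (s ^ 4 + r ^ 4)))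
          * (u.val + P * z) ^ 2) :=
  (qft_periodised P (summable_cgauss hr s) u).trans (karstWave hr hs (NeZero.ne P) _)

/-! ### The Karst-wave comb (§1.2 p. 4, second display; the integrality of Cond. C.5) -/

/-- **The comb mechanism.**  If the chirp rate `κ` is an EVEN INTEGER then, for `α > 0` and every `t`,
`Σ_{m∈ℤ} e^{-π(α − κi)(m+t)²} = e^{πiκt²} · α^{-1/2} · Σ_{j∈ℤ} e^{-(π/α)(j − κt)²} · e^{2πit(j − κt)}`:
the quadratic phase `e^{πiκm²}` is `1` on `ℤ` ("we can erase the `z²` term in the phase since `z ∈ Pℤ`",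
p. 4), the cross term `2κmt` is a linear phase, and Poisson summation (step "PSF") returns Gaussians of
rate `1/α` in `κt`, centred on `ℤ`.  Chen's printed condition is `κ/2 ∈ 2ℤ`; evenness of `κ` suffices.
[cite: ChenQuantumLattice2024, §1.2 p. 4; Cond. C.5 p. 19] -/
theorem karstWave_comb {α : ℝ} (hα : 0 < α) {κ : ℝ} (hκ : ∃ m : ℤ, κ = 2 * m) (t : ℂ) :
    ∑' m : ℤ, cexp (-π * (α - κ * I) * (m + t) ^ 2) =
      cexp (π * I * κ * t ^ 2) * (1 / (α : ℂ) ^ (1 / 2 : ℂ)) *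
        ∑' j : ℤ, cexp (-π / α * (j - κ * t) ^ 2) * cexp (2 * π * I * t * (j - κ * t)) := by
  obtain ⟨m₀, hm₀⟩ := hκ
  have hαre : 0 < (α : ℂ).re := by simpa using hα
  have herase : ∀ m : ℤ, cexp (π * I * κ * (m : ℂ) ^ 2) = 1 := by
    intro m
    have h : (π * I * κ * (m : ℂ) ^ 2) = ((m₀ * m ^ 2 : ℤ) : ℂ) * (2 * π * I) := by
      rw [hm₀]
      push_cast
      ring
    rw [h]
    exact Complex.exp_int_mul_two_pi_mul_I _
  have hL : ∀ m : ℤ, cexp (-π * (α - κ * I) * (m + t) ^ 2)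
      = cexp (π * I * κ * t ^ 2) *
          (cexp (-π * α * (m - (-t)) ^ 2) * cexp (-2 * π * I * m * (-(κ * t)))) := by
    intro m
    calc cexp (-π * (α - κ * I) * (m + t) ^ 2)
        = cexp (π * I * κ * (m : ℂ) ^ 2) * (cexp (π * I * κ * t ^ 2) *
            (cexp (-π * α * (m - (-t)) ^ 2) * cexp (-2 * π * I * m * (-(κ * t))))) := by
          rw [← Complex.exp_add, ← Complex.exp_add, ← Complex.exp_add]
          congr 1
          ring
      _ = _ := by rw [herase m, one_mul]
  simp_rw [hL]
  rw [tsum_mul_left, tsum_cexp_neg_quadratic_shift hαre (-t) (-(κ * t)), ← mul_assoc]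
  congr 1
  refine tsum_congr fun j => ?_
  congr 2
  all_goals ring

/-- **The Karst-wave comb in Chen's variables (§1.2 p. 4, the display ending the "proof").**  With
`α = r²s⁴/(s⁴+r⁴)`, `κ' = r⁴s²/(s⁴+r⁴)` (so `r²s²(s²−r²i)/(s⁴+r⁴) = α − κ'i`) and Chen's hypothesis
`s²r⁴/(2(s⁴+r⁴)) ∈ 2ℤ` taken verbatim, for every `t` (`= y/P`):
`Σ_{m∈ℤ} exp(-π r²s²(s²−r²i)/(s⁴+r⁴)·(m+t)²) = e^{πiκ't²} · α^{-1/2} · Σ_{j∈ℤ} exp(-π(s⁴+r⁴)/(r²s⁴)·(j − κ't)²)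
· e^{2πit(j − κ't)}` — the printed `exp(-π(s⁴+r⁴)/(r²s⁴)(z′ − r⁴s²y/(P(s⁴+r⁴)))²)·e^{πi r⁴s²y²/(P²(s⁴+r⁴))}·
e^{2πi⟨y, z′/P − r⁴s²y/(P²(s⁴+r⁴))⟩}` with its constant: `y` concentrates near `P(s⁴+r⁴)/(r⁴s²)·ℤ ≈ (P/s²)ℤ`.
[cite: ChenQuantumLattice2024, §1.2 p. 4; Cond. C.5 p. 19] -/
theorem karstWave_comb_chen {r s : ℝ} (hr : 0 < r) (hs : 0 < s)
    (hC : ∃ m : ℤ, s ^ 2 * r ^ 4 / (2 * (s ^ 4 + r ^ 4)) = 2 * m) (t : ℂ) :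
    ∑' m : ℤ, cexp (-π * ((r : ℂ) ^ 2 * s ^ 2 * (s ^ 2 - r ^ 2 * I) / (s ^ 4 + r ^ 4)) * (m + t) ^ 2) =
      cexp (π * I * (r ^ 4 * s ^ 2 / (s ^ 4 + r ^ 4) : ℝ) * t ^ 2) *
        (1 / ((r ^ 2 * s ^ 4 / (s ^ 4 + r ^ 4) : ℝ) : ℂ) ^ (1 / 2 : ℂ)) *
        ∑' j : ℤ, cexp (-π * (((s ^ 4 + r ^ 4) / (r ^ 2 * s ^ 4) : ℝ) : ℂ)
              * (j - (r ^ 4 * s ^ 2 / (s ^ 4 + r ^ 4) : ℝ) * t) ^ 2)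
          * cexp (2 * π * I * t * (j - (r ^ 4 * s ^ 2 / (s ^ 4 + r ^ 4) : ℝ) * t)) := by
  have h4r : (0 : ℝ) < s ^ 4 + r ^ 4 := by positivity
  have h4 : (s : ℂ) ^ 4 + r ^ 4 ≠ 0 := by exact_mod_cast h4r.ne'
  have hr' : (r : ℂ) ≠ 0 := by exact_mod_cast hr.ne'
  have hs' : (s : ℂ) ≠ 0 := by exact_mod_cast hs.ne'
  have hα : 0 < r ^ 2 * s ^ 4 / (s ^ 4 + r ^ 4) := by positivity
  obtain ⟨m, hm⟩ := hC
  have hκ : ∃ m' : ℤ, (r ^ 4 * s ^ 2 / (s ^ 4 + r ^ 4) : ℝ) = 2 * m' :=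
    ⟨2 * m, by
      have h4r' : (s ^ 4 + r ^ 4 : ℝ) ≠ 0 := h4r.ne'
      have e : (r ^ 4 * s ^ 2 / (s ^ 4 + r ^ 4) : ℝ) = 2 * (s ^ 2 * r ^ 4 / (2 * (s ^ 4 + r ^ 4))) := by
        field_simp
      rw [e, hm]
      push_cast
      ring⟩
  have h := karstWave_comb hα hκ t
  have e1 : (r : ℂ) ^ 2 * s ^ 2 * (s ^ 2 - r ^ 2 * I) / (s ^ 4 + r ^ 4)
      = ((r ^ 2 * s ^ 4 / (s ^ 4 + r ^ 4) : ℝ) : ℂ) - ((r ^ 4 * s ^ 2 / (s ^ 4 + r ^ 4) : ℝ) : ℂ) * I := by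
    push_cast
    field_simp
  have e2 : -(π : ℂ) * (((s ^ 4 + r ^ 4) / (r ^ 2 * s ^ 4) : ℝ) : ℂ)
      = -π / ((r ^ 2 * s ^ 4 / (s ^ 4 + r ^ 4) : ℝ) : ℂ) := by
    push_cast
    field_simp
  simp_rw [e1, e2]
  exact h

/-! ### Step 2, eq. (18): `QFT_{ℤ_Pⁿ}` of the untruncated Step-1 state `|φ′₁⟩`, exactly -/

section Step2

variable {n : ℕ}

/-- `‖kx − y‖² = k²‖x‖² − 2k⟨x,y⟩ + ‖y‖²` (the expansion used before (18)(a)). [folklore] -/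
theorem sum_sq_line (x y : Fin n → ℤ) (k : ℂ) :
    ∑ i, (k * (x i : ℂ) - (y i : ℂ)) ^ 2
      = k ^ 2 * ((x ⬝ᵥ x : ℤ) : ℂ) - 2 * k * ((x ⬝ᵥ y : ℤ) : ℂ) + ((y ⬝ᵥ y : ℤ) : ℂ) := by
  simp only [dotProduct]
  push_cast
  rw [Finset.mul_sum, Finset.mul_sum, ← Finset.sum_sub_distrib, ← Finset.sum_add_distrib]
  exact Finset.sum_congr rfl fun i _ => by ring

/-- `⟨kx − y, z⟩ = k⟨x,z⟩ − ⟨y,z⟩`. [folklore] -/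
theorem sum_line_mul (x y z : Fin n → ℤ) (k : ℂ) :
    ∑ i, (k * (x i : ℂ) - (y i : ℂ)) * (z i : ℂ) = k * ((x ⬝ᵥ z : ℤ) : ℂ) - ((y ⬝ᵥ z : ℤ) : ℂ) := by
  simp only [dotProduct]
  push_cast
  rw [Finset.mul_sum, ← Finset.sum_sub_distrib]
  exact Finset.sum_congr rfl fun i _ => by ring

/-- `Re(a‖x‖²) > 0` for `x ≠ 0` in `ℤⁿ`: the rate of the Gaussian in `k` in (18)(a). [folklore] -/
theorem re_mul_dotProduct_self_pos {a : ℂ} (ha : 0 < a.re) {x : Fin n → ℤ} (hx : x ≠ 0) :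
    0 < (a * ((x ⬝ᵥ x : ℤ) : ℂ)).re := by
  obtain ⟨i, hi⟩ := Function.ne_iff.mp hx
  have h : 0 < x ⬝ᵥ x := by
    unfold dotProduct
    exact Finset.sum_pos' (fun j _ => mul_self_nonneg _) ⟨i, Finset.mem_univ _, mul_self_pos.mpr hi⟩
  simp only [mul_re, intCast_re, intCast_im, mul_zero, sub_zero]
  exact mul_pos ha (by exact_mod_cast h)

/-- The amplitudes of `|φ′₁⟩` are absolutely summable in `k` (for `x ≠ 0`, `Re a > 0`).
[cite: ChenQuantumLattice2024, §3.5.1 p. 23] -/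
theorem summable_lineWindow {a : ℂ} (ha : 0 < a.re) {x : Fin n → ℤ} (hx : x ≠ 0) (y : Fin n → ℤ) :
    Summable fun k : ℤ => cexp (-π * a * ∑ i, ((k * x i - y i : ℤ) : ℂ) ^ 2) := by
  refine ((summable_cexp_neg_quadratic (re_mul_dotProduct_self_pos ha hx) (a * ((x ⬝ᵥ y : ℤ) : ℂ))).mul_left
    (cexp (-π * a * ((y ⬝ᵥ y : ℤ) : ℂ)))).congr fun k => ?_
  rw [← Complex.exp_add]
  congr 1
  push_cast
  rw [sum_sq_line]
  ring

/-- **Eq. (18), exactly (p. 24).**  For a rate `a` with `Re a > 0`, `x ≠ 0`, `y, z ∈ ℤⁿ`, `P ≥ 1`: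
`Σ_{k∈ℤ} e^{-πa‖kx−y‖²} e^{-2πi⟨kx−y,z⟩/P} = e^{-πa(‖y‖² − ⟨x,y⟩²/‖x‖²)} · e^{2πi⟨y,z⟩/P} · (a‖x‖²)^{-1/2} ·
Σ_{j∈ℤ} e^{-(π/(a‖x‖²))(j + ⟨x,z⟩/P)²} · e^{-2πi(⟨x,y⟩/‖x‖²)(j + ⟨x,z⟩/P)}` — Chen's (18): step (a)
(complete the square in `k`; the two factors `exp(-πa‖y‖²)`, `exp(+πa⟨x,y⟩²/‖x‖²)` he drops as "global
amplitude" are the first factor here) and step (b) (PSF + eq. (1), i.e. `tsum_cexp_neg_quadratic_shift` with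
rate `a‖x‖²`, centre `⟨x,y⟩/‖x‖²`, twist `⟨x,z⟩/P`). [cite: ChenQuantumLattice2024, eq. (18) p. 24] -/
theorem step2_tsum_exact {a : ℂ} (ha : 0 < a.re) {x : Fin n → ℤ} (hx : x ≠ 0) (y z : Fin n → ℤ)
    {P : ℕ} (hP : P ≠ 0) :
    ∑' k : ℤ, cexp (-π * a * ∑ i, ((k * x i - y i : ℤ) : ℂ) ^ 2) *
        cexp (-2 * π * I * ((∑ i, (k * x i - y i) * z i : ℤ) : ℂ) / P)
      = cexp (-π * a * (((y ⬝ᵥ y : ℤ) : ℂ) - ((x ⬝ᵥ y : ℤ) : ℂ) ^ 2 / ((x ⬝ᵥ x : ℤ) : ℂ))) *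
        cexp (2 * π * I * ((y ⬝ᵥ z : ℤ) : ℂ) / P) *
        (1 / (a * ((x ⬝ᵥ x : ℤ) : ℂ)) ^ (1 / 2 : ℂ)) *
        ∑' j : ℤ, cexp (-π / (a * ((x ⬝ᵥ x : ℤ) : ℂ)) * (j + ((x ⬝ᵥ z : ℤ) : ℂ) / P) ^ 2) *
          cexp (-2 * π * I * (((x ⬝ᵥ y : ℤ) : ℂ) / ((x ⬝ᵥ x : ℤ) : ℂ)) * (j + ((x ⬝ᵥ z : ℤ) : ℂ) / P)) := by
  have hA := re_mul_dotProduct_self_pos ha hx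
  have hX0 : ((x ⬝ᵥ x : ℤ) : ℂ) ≠ 0 := fun h => by simp [h] at hA
  have hP' : (P : ℂ) ≠ 0 := by exact_mod_cast hP
  have hterm : ∀ k : ℤ, cexp (-π * a * ∑ i, ((k * x i - y i : ℤ) : ℂ) ^ 2) *
        cexp (-2 * π * I * ((∑ i, (k * x i - y i) * z i : ℤ) : ℂ) / P)
      = (cexp (-π * a * (((y ⬝ᵥ y : ℤ) : ℂ) - ((x ⬝ᵥ y : ℤ) : ℂ) ^ 2 / ((x ⬝ᵥ x : ℤ) : ℂ))) *
          cexp (2 * π * I * ((y ⬝ᵥ z : ℤ) : ℂ) / P)) *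
        (cexp (-π * (a * ((x ⬝ᵥ x : ℤ) : ℂ)) * (k - ((x ⬝ᵥ y : ℤ) : ℂ) / ((x ⬝ᵥ x : ℤ) : ℂ)) ^ 2) *
          cexp (-2 * π * I * k * (((x ⬝ᵥ z : ℤ) : ℂ) / P))) := by
    intro k
    have e1 : (∑ i, ((k * x i - y i : ℤ) : ℂ) ^ 2)
        = (k : ℂ) ^ 2 * ((x ⬝ᵥ x : ℤ) : ℂ) - 2 * k * ((x ⬝ᵥ y : ℤ) : ℂ) + ((y ⬝ᵥ y : ℤ) : ℂ) := by
      push_cast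
      exact sum_sq_line x y k
    have e2 : ((∑ i, (k * x i - y i) * z i : ℤ) : ℂ) = (k : ℂ) * ((x ⬝ᵥ z : ℤ) : ℂ) - ((y ⬝ᵥ z : ℤ) : ℂ) := by
      push_cast
      exact sum_line_mul x y z k
    rw [e1, e2, ← Complex.exp_add, ← Complex.exp_add, ← Complex.exp_add, ← Complex.exp_add]
    congr 1
    field_simp
    ring
  simp_rw [hterm]
  rw [tsum_mul_left, tsum_cexp_neg_quadratic_shift hA]
  ring

/-- **Eq. (18) with Chen's constants.**  For `a = κ_{r,s} = 1/r² + i/s²` the dual rate in (18)(b) is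
`(κ‖x‖²)⁻¹ = r²s²(s²−r²i)/(‖x‖²(s⁴+r⁴))`, so the series on the right is literally Chen's
`Σ_{j∈ℤ} exp(-π s²r²(s²−r²i)/(‖x‖²(s⁴+r⁴))·(j + ⟨x,z⟩/P)²)·e^{-2πi(⟨x,y⟩/‖x‖²)(j + ⟨x,z⟩/P)}·e^{2πi⟨y,z/P⟩}`.
[cite: ChenQuantumLattice2024, eq. (18) p. 24; eq. (1) p. 3] -/
theorem step2_tsum_exact_chen {r s : ℝ} (hr : 0 < r) (hs : 0 < s) {x : Fin n → ℤ} (hx : x ≠ 0)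
    (y z : Fin n → ℤ) {P : ℕ} (hP : P ≠ 0) :
    ∑' k : ℤ, cexp (-π * karstRate r s * ∑ i, ((k * x i - y i : ℤ) : ℂ) ^ 2) *
        cexp (-2 * π * I * ((∑ i, (k * x i - y i) * z i : ℤ) : ℂ) / P)
      = cexp (-π * karstRate r s * (((y ⬝ᵥ y : ℤ) : ℂ) - ((x ⬝ᵥ y : ℤ) : ℂ) ^ 2 / ((x ⬝ᵥ x : ℤ) : ℂ))) *
        cexp (2 * π * I * ((y ⬝ᵥ z : ℤ) : ℂ) / P) *
        (1 / (karstRate r s * ((x ⬝ᵥ x : ℤ) : ℂ)) ^ (1 / 2 : ℂ)) *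
        ∑' j : ℤ, cexp (-π * ((r : ℂ) ^ 2 * s ^ 2 * (s ^ 2 - r ^ 2 * I)
              / (((x ⬝ᵥ x : ℤ) : ℂ) * (s ^ 4 + r ^ 4))) * (j + ((x ⬝ᵥ z : ℤ) : ℂ) / P) ^ 2) *
          cexp (-2 * π * I * (((x ⬝ᵥ y : ℤ) : ℂ) / ((x ⬝ᵥ x : ℤ) : ℂ)) * (j + ((x ⬝ᵥ z : ℤ) : ℂ) / P)) := by
  have h4 : (s : ℂ) ^ 4 + r ^ 4 ≠ 0 := by
    have h : (0 : ℝ) < s ^ 4 + r ^ 4 := by positivity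
    exact_mod_cast h.ne'
  have hA := re_mul_dotProduct_self_pos (karstRate_re_pos hr.ne' s) hx
  have hX0 : ((x ⬝ᵥ x : ℤ) : ℂ) ≠ 0 := fun h => by simp [h] at hA
  have hκ : karstRate r s ≠ 0 := fun h => by simpa [h] using karstRate_re_pos hr.ne' s
  rw [step2_tsum_exact (karstRate_re_pos hr.ne' s) hx y z hP]
  congr 1
  refine tsum_congr fun j => ?_
  congr 2
  rw [div_eq_mul_inv (-(π : ℂ)), mul_inv, inv_karstRate hr.ne' hs.ne']
  field_simp

/-- The untruncated Step-1 state `|φ′₁⟩ := Σ_{k∈ℤ} exp(-πa‖kx − y‖²)|kx − y mod P⟩` (p. 23, with rate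
`a = 1/r² + i/s²`; Lemma 3.10: `|φ′₁⟩ ≈_t |φ₁⟩`), as a state of `n` registers `ℤ_P` (`Ket` of
`ChenQuantumLWESteps`): the amplitude of `v ∈ ℤ_Pⁿ` collects every `k` with `kx − y ≡ v (mod P)`.
[cite: ChenQuantumLattice2024, §3.5.1 p. 23, Lemma 3.10 p. 23] -/
def phi1Prime (P : ℕ) (a : ℂ) (x y : Fin n → ℤ) : Ket n P :=
  fun v => ∑' k : ℤ, if (fun i => ((k * x i - y i : ℤ) : ZMod P)) = v
    then cexp (-π * a * ∑ i, ((k * x i - y i : ℤ) : ℂ) ^ 2) else 0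

/-- **Step 2 at the level of states: `|φ₂⟩ := QFT_{ℤ_Pⁿ}|φ′₁⟩` (eq. (18), first line, with `=` in place
of `≈_t` because the input is `|φ′₁⟩` itself).**  With Chen's `QFT_{ℤ_Pⁿ}` (`qft`, Lemma 2.12, kernel
`e^{-2πi⟨v,u⟩/P}`), the amplitude of `u ∈ ℤ_Pⁿ` in `QFT|φ′₁⟩` is `Σ_{k∈ℤ} e^{-πa‖kx−y‖²} e^{-2πi⟨kx−y,u⟩/P}`
(`u` read in `[0,P)ⁿ`; reducing `kx − y` mod `P` does not change the character).
[cite: ChenQuantumLattice2024, eq. (18) p. 24; Lemma 2.12 p. 12] -/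
theorem qft_phi1Prime {P : ℕ} [NeZero P] {a : ℂ} (ha : 0 < a.re) {x : Fin n → ℤ} (hx : x ≠ 0)
    (y : Fin n → ℤ) (u : Fin n → ZMod P) :
    qft (phi1Prime P a x y) u
      = ∑' k : ℤ, cexp (-π * a * ∑ i, ((k * x i - y i : ℤ) : ℂ) ^ 2) *
          cexp (-2 * π * I * ((∑ i, (k * x i - y i) * ((u i).val : ℤ) : ℤ) : ℂ) / P) := by
  classical
  set F : ℤ → ℂ := fun k => cexp (-π * a * ∑ i, ((k * x i - y i : ℤ) : ℂ) ^ 2) with hFdef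
  set pr : ℤ → (Fin n → ZMod P) := fun k i => ((k * x i - y i : ℤ) : ZMod P) with hprdef
  set c : (Fin n → ZMod P) → ℂ := fun v => e (-(((∑ i, (v i).val * (u i).val : ℕ) : ℚ) / P))
    with hcdef
  have hF : Summable F := summable_lineWindow ha hx y
  have hc : ∀ k : ℤ, c (pr k)
      = cexp (-2 * π * I * ((∑ i, (k * x i - y i) * ((u i).val : ℤ) : ℤ) : ℂ) / P) := by
    intro k
    simp only [hcdef, hprdef]
    have h1 : (-(((∑ i, (((k * x i - y i : ℤ) : ZMod P)).val * (u i).val : ℕ) : ℚ) / P))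
        = (((-((∑ i, (((k * x i - y i : ℤ) : ZMod P)).val * (u i).val : ℕ) : ℤ)) : ℤ) : ℚ) / P := by
      push_cast
      ring
    have h2 : (((-((∑ i, (((k * x i - y i : ℤ) : ZMod P)).val * (u i).val : ℕ) : ℤ)) : ℤ) : ZMod P)
        = (((-(∑ i, (k * x i - y i) * ((u i).val : ℤ))) : ℤ) : ZMod P) := by
      push_cast
      simp only [ZMod.natCast_val, ZMod.cast_id', id_eq]
    rw [h1, e_intCast_div_eq_stdAddChar, h2, ← e_intCast_div_eq_stdAddChar, e]
    congr 1
    push_cast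
    ring
  have step1 : qft (phi1Prime P a x y) u = ∑ v, ∑' k, (if pr k = v then F k * c v else 0) := by
    simp only [qft, phi1Prime, hFdef, hprdef, hcdef]
    refine Finset.sum_congr rfl fun v _ => ?_
    rw [← tsum_mul_right]
    refine tsum_congr fun k => ?_
    split_ifs <;> simp
  have step2 : ∑ v, ∑' k, (if pr k = v then F k * c v else 0)
      = ∑' k, ∑ v, (if pr k = v then F k * c v else 0) := by
    refine (Summable.tsum_finsetSum fun v _ => ?_).symm
    refine ((hF.mul_right (c v)).indicator {k | pr k = v}).congr fun k => ?_
    by_cases h : pr k = v <;> simp [h]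
  rw [step1, step2]
  refine tsum_congr fun k => ?_
  rw [Finset.sum_ite_eq, if_pos (Finset.mem_univ _), hc]

/-- **`|φ₂⟩` in closed form** (eq. (18), last line, exact and with its constants): the amplitude of `u` in
`QFT_{ℤ_Pⁿ}|φ′₁⟩` is `e^{-πa(‖y‖² − ⟨x,y⟩²/‖x‖²)} e^{2πi⟨y,u⟩/P} (a‖x‖²)^{-1/2} Σ_{j∈ℤ} e^{-(π/(a‖x‖²))(j + ⟨x,u⟩/P)²}
e^{-2πi(⟨x,y⟩/‖x‖²)(j + ⟨x,u⟩/P)}` (`u` read in `[0,P)ⁿ`; with `a = κ_{r,s}`, `(a‖x‖²)⁻¹ = r²s²(s²−r²i)/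
(‖x‖²(s⁴+r⁴))` by `inv_karstRate`, cf. `step2_tsum_exact_chen`).
[cite: ChenQuantumLattice2024, eq. (18) p. 24] -/
theorem qft_phi1Prime_eq {P : ℕ} [NeZero P] {a : ℂ} (ha : 0 < a.re) {x : Fin n → ℤ} (hx : x ≠ 0)
    (y : Fin n → ℤ) (u : Fin n → ZMod P) :
    qft (phi1Prime P a x y) u
      = cexp (-π * a * (((y ⬝ᵥ y : ℤ) : ℂ) - ((x ⬝ᵥ y : ℤ) : ℂ) ^ 2 / ((x ⬝ᵥ x : ℤ) : ℂ))) *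
        cexp (2 * π * I * ((y ⬝ᵥ (fun i => ((u i).val : ℤ)) : ℤ) : ℂ) / P) *
        (1 / (a * ((x ⬝ᵥ x : ℤ) : ℂ)) ^ (1 / 2 : ℂ)) *
        ∑' j : ℤ, cexp (-π / (a * ((x ⬝ᵥ x : ℤ) : ℂ))
              * (j + ((x ⬝ᵥ (fun i => ((u i).val : ℤ)) : ℤ) : ℂ) / P) ^ 2) *
          cexp (-2 * π * I * (((x ⬝ᵥ y : ℤ) : ℂ) / ((x ⬝ᵥ x : ℤ) : ℂ))
              * (j + ((x ⬝ᵥ (fun i => ((u i).val : ℤ)) : ℤ) : ℂ) / P)) := by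
  rw [qft_phi1Prime ha hx y u]
  exact step2_tsum_exact ha hx y (fun i => ((u i).val : ℤ)) (NeZero.ne P)

end Step2

end

end Literature.Computability.Cryptography.Chen2024
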